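import Mathlib
import HarnessLib
import Summits.Ventures.LatticeQCDFlow.Scoring.IMHAcceptanceRecord
import Summits.Ventures.LatticeQCDFlow.Scoring.SkeletonHoeffding
import Summits.Ventures.LatticeQCDFlow.Scoring.ChainBurnIn
import Summits.Ventures.LatticeQCDFlow.Scoring.DoeblinGreenKubo
import Summits.Ventures.LatticeQCDFlow.Exactness.ApproxTrivializingSampler

/-!
# The measured acceptance fraction of the exact flow-MCMC chain, from ANY start: an explicit
# Poisson solution for the accept flag, `|bias| ≤ 2(1 + 2/ε)/N`, and Gaussian tails
# `P(|(1/N) Σ_{i<N} A_i − ā| ≥ s) ≤ 2 exp(−(Ns − 2B̂)²/(2N B̂²))`, `B̂ = 1 + 2/ε`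

HONEST FRAMING: exact (Metropolis-corrected) sampling algorithms for lattice gauge theory;
figures of merit are autocorrelation/cost numbers at stated couplings and volumes; no
continuum-physics claim.

Venture `LatticeQCDFlow` (cell pub-lqcd), topic `Scoring`; FLOW lane (unit `pub-lqcd-flow`, GEN-37),
continuing `Scoring/IMHAcceptanceRecord.lean` (GEN-35: the record chain `Z_n = (X_n, A_n)` of the
flow-MCMC kernel `K = indepMH q w` — state and accept flag of the move that produced it — its kernel
`K̂ = Kernel.prodMkRight Bool (imhRecord q w)`, and `(kop K̂)^[t+1] A = (Kᵗ α) ∘ fst` with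
`α(x) = (imhAcceptMass q w x).toReal` the local acceptance rate) and
`Scoring/IMHAcceptanceRecordEnvelope.lean` (GEN-36: the stationary variance sandwich of the count;
NOT CLAIMED there: non-stationary starts, concentration of the count).  NEW WORK of the cell, not a
published result; no definition is introduced; nothing is cited as a fact.  Printed counterparts
NAMED ONLY: Glynn–Ormoneit (Statist. Probab. Lett. 56, 2002: Hoeffding bounds for uniformly
ergodic chains through the Poisson equation), Liu (Statist. Comput. 6, 1996: the independence
sampler), Meyn–Tweedie ch. 17 (the Poisson-equation route to limit theorems).

## The point

The acceptance column of a run is read from a cold or hot start, not from stationarity, and the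
record kernel `K̂((x, b), ·) = imhRecord q w x` is NOT minorised by its own invariant law
`π̂ = imhRecord q w ∘ₘ π` (a rejected move from `(x, b)` can only land on `(x, reject)`), so the
one-step Doeblin theorems of `Scoring/ChainHoeffding.lean` and `Scoring/ChainBurnIn.lean` do not
apply to the flag `A`.  They are not needed: a Doeblin constant enters those theorems only through a
bounded solution of the Poisson equation, and the record chain INHERITS one from the state chain —
if `g − Kg = α − c` on `Ω` then `ĥ(x, b) = A(x, b) + g(x)` solves `ĥ − K̂ĥ = A − c` on `Ω × Bool`
EXACTLY (`K̂A = α ∘ fst`, `K̂(g ∘ fst) = (Kg) ∘ fst`).  With `K(x, ·) ≥ ε π` the state chain gives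
`|g| ≤ 2/ε` for `c = ā = ∫ α dπ` (`|α − ā| ≤ 1`, Neumann series), so `|ĥ| ≤ B̂ = 1 + 2/ε`, and the
kernel-agnostic Poisson-form tail bound of `Scoring/SkeletonHoeffding.lean` together with the
Poisson-form bias bound of §1 apply to the record chain from EVERY initial law on `Ω × Bool`.

## Content

* §1 `chain_bias_le_of_poisson` — any Markov `κ`, any start `μ₀`, a bounded measurable `h`
  (`|h| ≤ B`) with `h − Kh = f − c`: for `N ≥ 1`, `|E_{μ₀}[(1/N) Σ_{i<N} f(X_i)] − c| ≤ 2B/N`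
  (the means telescope: `E f(X_i) − c = ∫ Kⁱh dμ₀ − ∫ Kⁱ⁺¹h dμ₀`; no invariant law is used).
* §2 `kop_imhRecord_acceptFlag` (`K̂A = α ∘ fst`), **`poisson_acceptFlag`** (the explicit solution),
  `abs_acceptRate_sub_integral_le_one` (`|α − ā| ≤ 1`), **`poisson_acceptFlag_exists_of_doeblin`**
  (`K(x, ·) ≥ ε π`, `π` invariant ⇒ a measurable `ĥ` with `|ĥ| ≤ 1 + 2/ε`, `ĥ − K̂ĥ = A − ā`).
* §3 For EVERY initial record law `μ̂₀` on `Ω × Bool` (the stationary `π̂` and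
  `imhRecord q w ∘ₘ μ₀`, the record after one move from any state law `μ₀`, are instances):
  **`acceptRecord_bias_le_of_doeblin`** `|E[(1/N) Σ_{i<N} A_i] − ā| ≤ 2B̂/N` and
  **`acceptRecord_abs_tail_le_exp_of_doeblin`**
  `P(|(1/N) Σ_{i<N} A_i − ā| ≥ s) ≤ 2 exp(−(Ns − 2B̂)²/(2N B̂²))` for `Ns ≥ 2B̂`, `B̂ = 1 + 2/ε`;
  `acceptRecord_bias_tail_of_le` — both from a weight bound `0 < w ≤ M`, `π = w · q`, `B̂ = 1 + 2M`.
* §4 **`flowSampler_acceptRecord_tail`** — the exact flow sampler on `SU(n)^E` under the hypotheses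
  of `Exactness.flowSampler_exact_doeblin` (uniform defect `δ` of Lüscher's equation):
  `B̂ = 1 + 2e^{2δ}`, both bounds at every volume, every `N ≥ 1`, from every start — UNCONDITIONAL.

Reading (value-free): the measured acceptance fraction of an exact flow-MCMC run thermalises within
`2(1 + 2e^{2δ})/N` of `ā` and carries a certified Gaussian radius of order `(1 + 2e^{2δ})/√N`, both
depending on the flow only through its defect; a measured acceptance outside that radius of a
model's `ā` is evidence against the model's `δ`, at any volume.  NOT CLAIMED: the value of `δ`, `ā`
or `ε` for any concrete flow or coupling; sharpness (in stationarity the variance of the count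
is `≤ (1 + 2(M − 1/ā)) N ā(1 − ā)`, GEN-36, far below `N B̂²`); a CLT for the count; cost.
-/

noncomputable section

namespace Summit.Ventures.LatticeQCDFlow.Scoring

open MeasureTheory ProbabilityTheory Filter Finset Preorder Summit.Ventures.LatticeQCDFlow.Exactness
open scoped ENNReal NNReal Topology

section General

variable {Ω : Type*} [MeasurableSpace Ω]
/-! ### §1 Thermalisation bias from a bounded Poisson solution — any kernel, any start -/

section PoissonBias

variable (κ : Kernel Ω Ω) [IsMarkovKernel κ] (μ₀ : Measure Ω) [IsProbabilityMeasure μ₀]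

/-- **Bias from a Poisson solution.**  For ANY Markov kernel `κ`, any initial law `μ₀`, a constant
`c` and a bounded measurable `h` (`|h| ≤ B`) with `h − kop κ h = f − c`: for every `N ≥ 1`,
`|E_{μ₀}[(1/N) Σ_{i<N} f(X_i)] − c| ≤ 2B/N`.  The per-coordinate means telescope,
`E_{μ₀} f(X_i) − c = ∫ (kop κ)^[i] h dμ₀ − ∫ (kop κ)^[i+1] h dμ₀`; no invariant law is needed. -/
theorem chain_bias_le_of_poisson {f h : Ω → ℝ} {c B : ℝ} (hh : Measurable h)
    (hhb : ∀ x, |h x| ≤ B) (hpois : ∀ x, h x - kop κ h x = f x - c) {N : ℕ} (hN : N ≠ 0) :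
    |∫ x, (∑ i ∈ Finset.range N, f (x i)) / N ∂(Kernel.trajMeasure (X := fun _ : ℕ => Ω) μ₀
        (fun m : ℕ => κ.comap (fun y : (i : ↥(Finset.Iic m)) → Ω => y ⟨m, Finset.mem_Iic.2 le_rfl⟩)
          (measurable_pi_apply _))) - c| ≤ 2 * B / N := by
  set P := Kernel.trajMeasure (X := fun _ : ℕ => Ω) μ₀
      (fun m : ℕ => κ.comap (fun y : (i : ↥(Finset.Iic m)) → Ω => y ⟨m, Finset.mem_Iic.2 le_rfl⟩)
        (measurable_pi_apply _)) with hP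
  have hKm : Measurable (kop κ h) := measurable_kop κ hh
  have hKb : ∀ x, |kop κ h x| ≤ B := abs_kop_le κ hhb
  -- `f = (h − Kh) + c` is measurable and bounded, `f − c` is bounded by `2B`
  have hfeq : f = fun y => h y - kop κ h y + c := funext fun y => by linarith [hpois y]
  have hfm : Measurable f := by rw [hfeq]; exact (hh.sub hKm).add_const c
  have hgb : ∀ y, |f y - c| ≤ 2 * B := fun y => by
    rw [← hpois y]
    obtain ⟨h1, h2⟩ := abs_le.1 (hhb y)
    obtain ⟨h3, h4⟩ := abs_le.1 (hKb y)
    exact abs_le.2 ⟨by linarith, by linarith⟩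
  have hfb : ∀ y, |f y| ≤ 2 * B + |c| := fun y => by
    obtain ⟨h1, h2⟩ := abs_le.1 (hgb y)
    exact abs_le.2 ⟨by linarith [neg_abs_le c], by linarith [le_abs_self c]⟩
  have hNpos : (0 : ℝ) < N := by exact_mod_cast Nat.pos_of_ne_zero hN
  have hint : ∀ i, Integrable (fun x : ℕ → Ω => f (x i)) P := fun i =>
    integrable_of_bounded P (hfm.comp (measurable_pi_apply i)) fun x => hfb (x i)
  -- per coordinate: `E f(X_i) − c = a_i − a_{i+1}`, `a_i = ∫ (kop κ)^[i] h dμ₀`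
  have hstep : ∀ i, ∫ x, f (x i) ∂P - c
      = ∫ x, (kop κ)^[i] h x ∂μ₀ - ∫ x, (kop κ)^[i + 1] h x ∂μ₀ := fun i => by
    obtain ⟨hm, hb⟩ := iterate_kop_bounded_measurable κ hh hhb i
    obtain ⟨hm1, hb1⟩ := iterate_kop_bounded_measurable κ hh hhb (i + 1)
    have e1 : ∫ x, f (x i) ∂P - c = ∫ x, (f (x i) - c) ∂P := by
      rw [integral_sub (hint i) (integrable_const c), integral_const, probReal_univ, one_smul]
    rw [e1, hP, chain_expect κ μ₀ (hfm.sub_const c) hgb i,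
      iterate_kop_poisson (f := fun y => f y - c) hh hhb (fun y => hpois y) i]
    exact integral_sub (integrable_of_bounded μ₀ hm hb) (integrable_of_bounded μ₀ hm1 hb1)
  -- the mean of the average is the average of the means, and the means telescope
  have hmean : ∫ x, (∑ i ∈ Finset.range N, f (x i)) / N ∂P
      = (∑ i ∈ Finset.range N, ∫ x, f (x i) ∂P) / N := by
    rw [show (fun x : ℕ → Ω => (∑ i ∈ Finset.range N, f (x i)) / N)
        = fun x => (N : ℝ)⁻¹ * ∑ i ∈ Finset.range N, f (x i) by funext x; rw [div_eq_inv_mul],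
      integral_const_mul, integral_finsetSum _ (fun i _ => hint i), ← div_eq_inv_mul]
  have hsub : (∑ i ∈ Finset.range N, ∫ x, f (x i) ∂P) / N - c
      = (∑ i ∈ Finset.range N, (∫ x, f (x i) ∂P - c)) / N := by
    rw [Finset.sum_sub_distrib, Finset.sum_const, Finset.card_range, nsmul_eq_mul]
    field_simp
  have htel : ∑ i ∈ Finset.range N, (∫ x, f (x i) ∂P - c)
      = ∫ x, (kop κ)^[0] h x ∂μ₀ - ∫ x, (kop κ)^[N] h x ∂μ₀ := by
    simp_rw [hstep]
    exact Finset.sum_range_sub' (fun i => ∫ x, (kop κ)^[i] h x ∂μ₀) N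
  have hbd : ∀ i, |∫ x, (kop κ)^[i] h x ∂μ₀| ≤ B := fun i => by
    obtain ⟨-, hb⟩ := iterate_kop_bounded_measurable κ hh hhb i
    calc |∫ x, (kop κ)^[i] h x ∂μ₀| = ‖∫ x, (kop κ)^[i] h x ∂μ₀‖ := (Real.norm_eq_abs _).symm
      _ ≤ B * μ₀.real Set.univ := norm_integral_le_of_norm_le_const
          (Eventually.of_forall fun x => by rw [Real.norm_eq_abs]; exact hb x)
      _ = B := by rw [probReal_univ, mul_one]
  obtain ⟨h0l, h0u⟩ := abs_le.1 (hbd 0)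
  obtain ⟨hNl, hNu⟩ := abs_le.1 (hbd N)
  rw [hmean, hsub, htel, abs_div, abs_of_pos hNpos]
  exact div_le_div_of_nonneg_right (abs_le.2 ⟨by linarith, by linarith⟩) hNpos.le

end PoissonBias

/-! ### §2 The explicit Poisson solution for the accept flag -/

section Record

variable {q : Measure Ω} [IsProbabilityMeasure q] {w : Ω → ℝ}

/-- **The flag's one-step conditional mean is the local acceptance rate of the current state**:
`kop K̂ A = α ∘ fst` (the case `t = 0` of `iterate_kop_imhRecord_acceptFlag`). -/
theorem kop_imhRecord_acceptFlag (hw : Measurable w) (hw0 : ∀ x, 0 < w x) :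
    kop (Kernel.prodMkRight Bool (imhRecord q w)) acceptFlag
      = fun z => (imhAcceptMass q w z.1).toReal := by
  have h := iterate_kop_imhRecord_acceptFlag (q := q) hw hw0 0
  simpa only [zero_add, Function.iterate_one, Function.iterate_zero_apply] using h

/-- **THE EXPLICIT POISSON SOLUTION FOR THE FLAG.**  If a bounded measurable `g` solves the state
chain's Poisson equation `g − kop K g = α − c` on `Ω` (`K = indepMH q w`, any constant `c`), then
`ĥ(x, b) = A(x, b) + g(x)` solves the record chain's equation `ĥ − kop K̂ ĥ = A − c` on `Ω × Bool`,
because `kop K̂ A = α ∘ fst` and `kop K̂ (g ∘ fst) = (kop K g) ∘ fst`. -/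
theorem poisson_acceptFlag (hw : Measurable w) (hw0 : ∀ x, 0 < w x) {g : Ω → ℝ}
    (hg : Measurable g) {C : ℝ} (hC : ∀ x, |g x| ≤ C) {c : ℝ}
    (hpois : ∀ x, g x - kop (indepMH q w) g x = (imhAcceptMass q w x).toReal - c)
    (z : Ω × Bool) :
    (acceptFlag z + g z.1)
        - kop (Kernel.prodMkRight Bool (imhRecord q w)) (fun z => acceptFlag z + g z.1) z
      = acceptFlag z - c := by
  haveI : Fact (Measurable w) := ⟨hw⟩
  have hadd : kop (Kernel.prodMkRight Bool (imhRecord q w)) (fun z => acceptFlag z + g z.1) z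
      = kop (Kernel.prodMkRight Bool (imhRecord q w)) acceptFlag z
        + kop (Kernel.prodMkRight Bool (imhRecord q w)) (fun z => g z.1) z := by
    unfold kop
    exact integral_add (integrable_of_bounded _ measurable_acceptFlag abs_acceptFlag_le)
      (integrable_of_bounded _ (hg.comp measurable_fst) fun z => hC z.1)
  rw [hadd, kop_imhRecord_acceptFlag hw hw0, kop_imhRecord_comp_fst hw hw0 hg hC]
  show acceptFlag z + g z.1 - ((imhAcceptMass q w z.1).toReal + kop (indepMH q w) g z.1)
    = acceptFlag z - c
  linarith [hpois z.1]

variable {π : Measure Ω}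

/-- `|α(x) − ā| ≤ 1`: the local acceptance rate and its mean under any probability law `π` both
lie in `[0, 1]`. -/
theorem abs_acceptRate_sub_integral_le_one [IsProbabilityMeasure π] (x : Ω) :
    |(imhAcceptMass q w x).toReal - ∫ y, (imhAcceptMass q w y).toReal ∂π| ≤ 1 := by
  have h0 : ∀ y, 0 ≤ (imhAcceptMass q w y).toReal := fun _ => ENNReal.toReal_nonneg
  have h1 : ∀ y, (imhAcceptMass q w y).toReal ≤ 1 := fun y =>
    (le_abs_self _).trans (abs_toReal_imhAcceptMass_le (q := q) (w := w) y)
  have hm0 : 0 ≤ ∫ y, (imhAcceptMass q w y).toReal ∂π := integral_nonneg h0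
  have hm1 : ∫ y, (imhAcceptMass q w y).toReal ∂π ≤ 1 :=
    calc ∫ y, (imhAcceptMass q w y).toReal ∂π ≤ ∫ _, (1 : ℝ) ∂π :=
          integral_mono_of_nonneg (Eventually.of_forall h0) (integrable_const 1)
            (Eventually.of_forall h1)
      _ = 1 := by rw [integral_const, probReal_univ, one_smul]
  exact abs_le.2 ⟨by linarith [h0 x], by linarith [h1 x]⟩

/-- **A bounded Poisson solution for the flag from a Doeblin constant of the STATE chain.**  If
`π` is an invariant probability law of `K = indepMH q w` with `K(x, ·) ≥ ε π` (`ε > 0`), there is a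
measurable `ĥ` on `Ω × Bool` with `|ĥ| ≤ 1 + 2/ε` and `ĥ − kop K̂ ĥ = A − ā`, `ā = ∫ α dπ`:
namely `ĥ = A + g ∘ fst` with `g` the Neumann-series solution of `g − Kg = α − ā`
(`poisson_exists_of_doeblin`, `|α − ā| ≤ 1` ⇒ `|g| ≤ 2/ε`).  The record kernel itself is not
minorised by its invariant law; this is how the flag nevertheless gets a Poisson solution. -/
theorem poisson_acceptFlag_exists_of_doeblin (hw : Measurable w) (hw0 : ∀ x, 0 < w x)
    [IsProbabilityMeasure π] (hinv : Kernel.Invariant (indepMH q w) π) {ε : ℝ≥0∞}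
    (hmin : ∀ x {B : Set Ω}, MeasurableSet B → ε * π B ≤ indepMH q w x B) (hε0 : 0 < ε) :
    ∃ H : Ω × Bool → ℝ, Measurable H ∧ (∀ z, |H z| ≤ 1 + 2 / ε.toReal) ∧
      ∀ z, H z - kop (Kernel.prodMkRight Bool (imhRecord q w)) H z
        = acceptFlag z - ∫ y, (imhAcceptMass q w y).toReal ∂π := by
  haveI : Fact (Measurable w) := ⟨hw⟩
  have hαm := measurable_toReal_imhAcceptMass (q := q) hw
  have hfm : Measurable fun x =>
      (imhAcceptMass q w x).toReal - ∫ y, (imhAcceptMass q w y).toReal ∂π := hαm.sub_const _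
  have hf0 : ∫ x, ((imhAcceptMass q w x).toReal - ∫ y, (imhAcceptMass q w y).toReal ∂π) ∂π = 0 := by
    rw [integral_sub (integrable_of_bounded π hαm abs_toReal_imhAcceptMass_le) (integrable_const _),
      integral_const, probReal_univ, one_smul, sub_self]
  obtain ⟨g, hgm, hgb, hg⟩ := poisson_exists_of_doeblin hinv hmin hε0 hfm
    (fun x => abs_acceptRate_sub_integral_le_one (q := q) (w := w) (π := π) x) hf0
  refine ⟨fun z => acceptFlag z + g z.1, measurable_acceptFlag.add (hgm.comp measurable_fst),
    fun z => ?_, fun z => poisson_acceptFlag hw hw0 hgm hgb (fun x => hg x) z⟩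
  obtain ⟨h1, h2⟩ := abs_le.1 (abs_acceptFlag_le z)
  obtain ⟨h3, h4⟩ := abs_le.1 (hgb z.1)
  have he : 2 * (1 : ℝ) / ε.toReal = 2 / ε.toReal := by rw [mul_one]
  rw [he] at h3 h4
  show |acceptFlag z + g z.1| ≤ 1 + 2 / ε.toReal
  exact abs_le.2 ⟨by linarith, by linarith⟩

/-! ### §3 The acceptance fraction from ANY start: certified thermalisation and Gaussian tails -/

section Path

variable [Fact (Measurable w)] [IsProbabilityMeasure π]

/-- **CERTIFIED THERMALISATION OF THE ACCEPTANCE COLUMN, from any start.**  With `π` invariant for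
`K = indepMH q w` and `K(x, ·) ≥ ε π` (`ε > 0`): for EVERY initial law `μ̂₀` of the record chain on
`Ω × Bool` and every `N ≥ 1`,
`|E_{μ̂₀}[(1/N) Σ_{i<N} A_i] − ā| ≤ 2(1 + 2/ε)/N`, `ā = ∫ α dπ` the equilibrium acceptance. -/
theorem acceptRecord_bias_le_of_doeblin (hw0 : ∀ x, 0 < w x)
    (hinv : Kernel.Invariant (indepMH q w) π) {ε : ℝ≥0∞}
    (hmin : ∀ x {B : Set Ω}, MeasurableSet B → ε * π B ≤ indepMH q w x B) (hε0 : 0 < ε)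
    (μ₀ : Measure (Ω × Bool)) [IsProbabilityMeasure μ₀] {N : ℕ} (hN : N ≠ 0) :
    |∫ x, (∑ i ∈ Finset.range N, acceptFlag (x i)) / N
        ∂(Kernel.trajMeasure (X := fun _ : ℕ => Ω × Bool) μ₀
          (fun m : ℕ => (Kernel.prodMkRight Bool (imhRecord q w)).comap
            (fun y : (i : ↥(Finset.Iic m)) → Ω × Bool => y ⟨m, Finset.mem_Iic.2 le_rfl⟩)
            (measurable_pi_apply _)))
      - ∫ y, (imhAcceptMass q w y).toReal ∂π| ≤ 2 * (1 + 2 / ε.toReal) / N := by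
  obtain ⟨H, hHm, hHb, hH⟩ :=
    poisson_acceptFlag_exists_of_doeblin (q := q) (π := π) Fact.out hw0 hinv hmin hε0
  exact chain_bias_le_of_poisson (Kernel.prodMkRight Bool (imhRecord q w)) μ₀ hHm hHb hH hN

/-- **GAUSSIAN TAILS FOR THE ACCEPTANCE FRACTION, from any start.**  Under the same hypotheses,
with `B̂ = 1 + 2/ε`: for EVERY initial record law `μ̂₀`, every `N ≥ 1` and `s` with `N s ≥ 2B̂`,
`P_{μ̂₀}(|(1/N) Σ_{i<N} A_i − ā| ≥ s) ≤ 2 exp(−(N s − 2B̂)² / (2 N B̂²))`. -/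
theorem acceptRecord_abs_tail_le_exp_of_doeblin (hw0 : ∀ x, 0 < w x)
    (hinv : Kernel.Invariant (indepMH q w) π) {ε : ℝ≥0∞}
    (hmin : ∀ x {B : Set Ω}, MeasurableSet B → ε * π B ≤ indepMH q w x B) (hε0 : 0 < ε)
    (μ₀ : Measure (Ω × Bool)) [IsProbabilityMeasure μ₀] {N : ℕ} (hN : N ≠ 0) {s : ℝ}
    (hs : 2 * (1 + 2 / ε.toReal) ≤ N * s) :
    (Kernel.trajMeasure (X := fun _ : ℕ => Ω × Bool) μ₀
          (fun m : ℕ => (Kernel.prodMkRight Bool (imhRecord q w)).comap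
            (fun y : (i : ↥(Finset.Iic m)) → Ω × Bool => y ⟨m, Finset.mem_Iic.2 le_rfl⟩)
            (measurable_pi_apply _))).real
        {x | s ≤ |(∑ i ∈ Finset.range N, acceptFlag (x i)) / N
          - ∫ y, (imhAcceptMass q w y).toReal ∂π|}
      ≤ 2 * Real.exp (-(N * s - 2 * (1 + 2 / ε.toReal)) ^ 2
          / (2 * N * (1 + 2 / ε.toReal) ^ 2)) := by
  obtain ⟨H, hHm, hHb, hH⟩ :=
    poisson_acceptFlag_exists_of_doeblin (q := q) (π := π) Fact.out hw0 hinv hmin hε0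
  exact chain_abs_tail_le_exp_of_poisson (Kernel.prodMkRight Bool (imhRecord q w)) μ₀ hHm hHb hH
    hN hs

/-- **From a weight bound.**  If `0 < w ≤ M` and `π = w · q` is a probability law, then
`K(x, ·) ≥ M⁻¹ π` (`indepMH_apply_ge`) and `π` is invariant (`indepMH_invariant`), so both bounds
hold with `B̂ = 1 + 2M`: for every initial record law `μ̂₀` and `N ≥ 1`,
`|E[(1/N) Σ_{i<N} A_i] − ā| ≤ 2(1 + 2M)/N`, and for `N s ≥ 2(1 + 2M)`,
`P(|(1/N) Σ_{i<N} A_i − ā| ≥ s) ≤ 2 exp(−(N s − 2(1 + 2M))² / (2 N (1 + 2M)²))`. -/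
theorem acceptRecord_bias_tail_of_le (hw0 : ∀ x, 0 < w x) {M : ℝ} (hM : ∀ x, w x ≤ M)
    (hπ : (q.withDensity fun x => ENNReal.ofReal (w x)) = π)
    (μ₀ : Measure (Ω × Bool)) [IsProbabilityMeasure μ₀] {N : ℕ} (hN : N ≠ 0) :
    |∫ x, (∑ i ∈ Finset.range N, acceptFlag (x i)) / N
        ∂(Kernel.trajMeasure (X := fun _ : ℕ => Ω × Bool) μ₀
          (fun m : ℕ => (Kernel.prodMkRight Bool (imhRecord q w)).comap
            (fun y : (i : ↥(Finset.Iic m)) → Ω × Bool => y ⟨m, Finset.mem_Iic.2 le_rfl⟩)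
            (measurable_pi_apply _)))
      - ∫ y, (imhAcceptMass q w y).toReal ∂π| ≤ 2 * (1 + 2 * M) / N ∧
    ∀ s : ℝ, 2 * (1 + 2 * M) ≤ N * s →
      (Kernel.trajMeasure (X := fun _ : ℕ => Ω × Bool) μ₀
            (fun m : ℕ => (Kernel.prodMkRight Bool (imhRecord q w)).comap
              (fun y : (i : ↥(Finset.Iic m)) → Ω × Bool => y ⟨m, Finset.mem_Iic.2 le_rfl⟩)
              (measurable_pi_apply _))).real
          {x | s ≤ |(∑ i ∈ Finset.range N, acceptFlag (x i)) / N
            - ∫ y, (imhAcceptMass q w y).toReal ∂π|}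
        ≤ 2 * Real.exp (-(N * s - 2 * (1 + 2 * M)) ^ 2 / (2 * N * (1 + 2 * M) ^ 2)) := by
  have hw : Measurable w := Fact.out
  obtain ⟨x0⟩ := nonempty_of_isProbabilityMeasure π
  have hMpos : 0 < M := (hw0 x0).trans_le (hM x0)
  have hmin : ∀ x {B : Set Ω}, MeasurableSet B → (ENNReal.ofReal M)⁻¹ * π B ≤ indepMH q w x B :=
    fun x B hB => by have h := indepMH_apply_ge (q := q) hw hw0 hM x hB; rwa [hπ] at h
  have hε0 : 0 < (ENNReal.ofReal M)⁻¹ := ENNReal.inv_pos.2 ENNReal.ofReal_ne_top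
  have hinv : Kernel.Invariant (indepMH q w) π := hπ ▸ indepMH_invariant hw hw0
  have he : 2 / ((ENNReal.ofReal M)⁻¹).toReal = 2 * M := by
    rw [ENNReal.toReal_inv, ENNReal.toReal_ofReal hMpos.le, div_inv_eq_mul]
  refine ⟨?_, fun s hs => ?_⟩
  · have h := acceptRecord_bias_le_of_doeblin (q := q) hw0 hinv hmin hε0 μ₀ hN
    rwa [he] at h
  · have h := acceptRecord_abs_tail_le_exp_of_doeblin (q := q) hw0 hinv hmin hε0 μ₀ hN (s := s)
      (by rwa [he])
    rwa [he] at h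

end Path
end Record
end General

/-! ### §4 The exact flow sampler on `SU(n)^E` — UNCONDITIONAL, from any start -/

section Lattice

open Summit.Ventures.LatticeQCDFlow.Exactness
open Literature.MathematicalPhysics.QuantumFieldTheory
open Literature.MathematicalPhysics.QuantumFieldTheory.Luscher2010
open Summit.Ventures.LatticeQCDFlow.TrivializingMaps
open scoped Matrix Matrix.Norms.Frobenius ContDiff

variable {d L n : ℕ} [NeZero L]

/-- **THE ACCEPTANCE COLUMN OF THE EXACT FLOW SAMPLER THERMALISES AND CONCENTRATES, from any
start — UNCONDITIONAL.**  Under the hypotheses of `Exactness.flowSampler_exact_doeblin` (smooth `S`,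
jointly smooth flow action with uniform defect `δ` of Lüscher's equation on `[0,1] × SU(n)^E`,
`q = (𝓕_1)_* D[V]`): there is a weight `w` (measurable, `w · q = 𝒵⁻¹e^{−S}D[U]`, the flow-MCMC
kernel leaves the Boltzmann law `π` invariant) such that for EVERY initial law `μ̂₀` of the record
chain (state, accept flag) and every `N ≥ 1`, with `B̂ = 1 + 2e^{2δ}` and `ā = ∫ α dπ`:
`|E_{μ̂₀}[(1/N) Σ_{i<N} A_i] − ā| ≤ 2B̂/N`, and for `N s ≥ 2B̂`,
`P_{μ̂₀}(|(1/N) Σ_{i<N} A_i − ā| ≥ s) ≤ 2 exp(−(N s − 2B̂)² / (2 N B̂²))` — at every volume.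
(The instance binder `[Fact (Measurable w)]` is supplied by `⟨hw⟩`.) -/
theorem flowSampler_acceptRecord_tail (B : SuBasis n)
    {S : AmbConfig d L n → ℝ} (hS : ContDiff ℝ ∞ S) {F : ℝ → AmbConfig d L n → ℝ}
    (hF : ContDiff ℝ ∞ fun p : ℝ × AmbConfig d L n => F p.1 p.2)
    {Φ : ℝ → GaugeConfig d L (Matrix.specialUnitaryGroup (Fin n) ℂ) →
      GaugeConfig d L (Matrix.specialUnitaryGroup (Fin n) ℂ)}
    (hΦ : IsFlowMap (fun t W => -linkGrad B (F t) W) Φ) {c : ℝ → ℝ} {δ : ℝ}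
    (hδ : ∀ t ∈ Set.Icc (0 : ℝ) 1, ∀ U : GaugeConfig d L (Matrix.specialUnitaryGroup (Fin n) ℂ),
      |luscherL B S t (F t) (WilsonFlow.coeConfig U) - S (WilsonFlow.coeConfig U) - c t| ≤ δ)
    (q : Measure (GaugeConfig d L (Matrix.specialUnitaryGroup (Fin n) ℂ))) [IsProbabilityMeasure q]
    (hq : q = Measure.map (Φ 1) (trivialMeasure (Matrix.specialUnitaryGroup (Fin n) ℂ) d L)) :
    ∃ w : GaugeConfig d L (Matrix.specialUnitaryGroup (Fin n) ℂ) → ℝ, Measurable w ∧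
      (q.withDensity fun U => ENNReal.ofReal (w U)) =
        boltzmannMeasure (fun U : GaugeConfig d L (Matrix.specialUnitaryGroup (Fin n) ℂ) =>
          S (WilsonFlow.coeConfig U)) ∧
      Kernel.Invariant (indepMH q w)
        (boltzmannMeasure fun U : GaugeConfig d L (Matrix.specialUnitaryGroup (Fin n) ℂ) =>
          S (WilsonFlow.coeConfig U)) ∧
      ∀ [Fact (Measurable w)]
        (μ₀ : Measure (GaugeConfig d L (Matrix.specialUnitaryGroup (Fin n) ℂ) × Bool))
        [IsProbabilityMeasure μ₀] (N : ℕ), N ≠ 0 →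
        let π := boltzmannMeasure fun U : GaugeConfig d L (Matrix.specialUnitaryGroup (Fin n) ℂ) =>
          S (WilsonFlow.coeConfig U)
        let P := Kernel.trajMeasure
          (X := fun _ : ℕ => GaugeConfig d L (Matrix.specialUnitaryGroup (Fin n) ℂ) × Bool) μ₀
          (fun m : ℕ => (Kernel.prodMkRight Bool (imhRecord q w)).comap
            (fun y : (i : ↥(Finset.Iic m)) →
                GaugeConfig d L (Matrix.specialUnitaryGroup (Fin n) ℂ) × Bool =>
              y ⟨m, Finset.mem_Iic.2 le_rfl⟩) (measurable_pi_apply _))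
        |∫ x, (∑ i ∈ Finset.range N, acceptFlag (x i)) / N ∂P
            - ∫ U, (imhAcceptMass q w U).toReal ∂π| ≤ 2 * (1 + 2 * Real.exp (2 * δ)) / N ∧
          ∀ s : ℝ, 2 * (1 + 2 * Real.exp (2 * δ)) ≤ N * s →
            P.real {x | s ≤ |(∑ i ∈ Finset.range N, acceptFlag (x i)) / N
                - ∫ U, (imhAcceptMass q w U).toReal ∂π|}
              ≤ 2 * Real.exp (-(N * s - 2 * (1 + 2 * Real.exp (2 * δ))) ^ 2
                  / (2 * N * (1 + 2 * Real.exp (2 * δ)) ^ 2)) := by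
  obtain ⟨w, hw, hlo, -, hπ, hinv, -, hdoeb⟩ := flowSampler_exact_doeblin B hS hF hΦ hδ q hq
  refine ⟨w, hw, hπ, hinv, ?_⟩
  intro hFw μ₀ hμ₀ N hN
  have hS'c : Continuous fun U : GaugeConfig d L (Matrix.specialUnitaryGroup (Fin n) ℂ) =>
      S (WilsonFlow.coeConfig U) := hS.continuous.comp WilsonFlow.continuous_coeConfig
  haveI := isProbabilityMeasure_boltzmannMeasure (d := d) (L := L) hS'c
  have hε0 : 0 < ENNReal.ofReal (Real.exp (-(2 * δ))) := ENNReal.ofReal_pos.2 (Real.exp_pos _)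
  have hw0 : ∀ U, 0 < w U := fun U => (Real.exp_pos _).trans_le (hlo U)
  have he : 2 / (ENNReal.ofReal (Real.exp (-(2 * δ)))).toReal = 2 * Real.exp (2 * δ) := by
    rw [ENNReal.toReal_ofReal (Real.exp_pos _).le, Real.exp_neg, div_inv_eq_mul]
  refine ⟨?_, fun s hs => ?_⟩
  · have h := acceptRecord_bias_le_of_doeblin (q := q) hw0 hinv (fun U A hA => hdoeb U hA) hε0 μ₀ hN
    rwa [he] at h
  · have h := acceptRecord_abs_tail_le_exp_of_doeblin (q := q) hw0 hinv (fun U A hA => hdoeb U hA)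
      hε0 μ₀ hN (s := s) (by rwa [he])
    rwa [he] at h

end Lattice

end Summit.Ventures.LatticeQCDFlow.Scoring

end
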